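import Mathlib
import Literature.Probability.LatticeModels.TorusFourierDyadicMoments
import Literature.MathematicalPhysics.QuantumLattice.FramePosKernelL1
import HarnessLib

/-!
# The FIRST MOMENT `Σ_z |z̃|_∞ ‖Ǩ_L(z)‖` of a frame's lattice position kernel from the frame's FIRST and THIRD directional derivatives

Topic `MathematicalPhysics/QuantumLattice`; companion of `FramePosKernelL1.lean` (the `ℓ¹` size `Σ_z ‖Ǩ_L(z)‖` of
`framePosKernel L K : Ǩ_L(z) = L⁻² Σ_q K(p_q) conj χ_q(z)` from first and second unit differences — the global-weight Plancherel route
of `TorusFourierWienerBound`).  A first MOMENT by that route costs three unit differences everywhere and interpolates the orders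
`0` and `3` of the frame (`‖K‖_∞^{1/3}‖D³K‖_∞^{2/3}`); here Bernstein's DYADIC route (`TorusFourierDyadicBlocks` / `…Moments`): the shell
`{2^j ≤ |z̃|_∞ < 2^{j+1}}` is paid by the `N`-th COARSE difference of the samples `q ↦ K(p_q)` at step `2π m(2^j)/L ≤ π/2^j`, which is
the `N`-th continuum difference of `K` along an axis (periodicity), hence `≤ (π/2^j)^N·‖∂_i^N K‖_∞` (iterated mean-value theorem) —
for EVERY `N`, shell by shell.  With the first and third directional derivative laws:

  `Σ_z |z̃|_∞·‖Ǩ_L(z)‖ ≤ 32√2·π·B₁·2^t + 1024√2·π³·B₃/2^t`   for every integer crossover `t`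
  (**`sum_torusSupNorm_mul_norm_framePosKernel_le`**; `B_N ≥ sup_{p,l,s} |∂_s^N K(p + s e_l)|`),

uniformly in `L` — i.e. `≲ √(B₁B₃)` with `2^t ≍ √(B₃/B₁)`.  For a frame piece with `‖DK‖ ≍ Gfr₁U²4^{-n}`, `‖D³K‖ ≍ Gfr₃U²4^{n}` this is
`≍ √(Gfr₁Gfr₃)·U²` uniformly in `n` (take `2^t = 4^n`), the input of the `n`-uniform first-moment bound for the KL-regime counterterm
(cell gate-hubbard-kl, route (E4-b)).

* §1 `fwdDiff_iter_ofReal` — forward differences commute with `ℝ ↪ ℂ`; `fwdDiff_iter_sample_eq` — the `N`-th lattice difference at step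
  `m•e_l` of the samples of a `(2πℤ)²`-periodic `Φ` IS the `N`-th continuum difference of `Φ` at step `(2πm/L)e_l`, sampled;
* §2 **`norm_fwdDiff_iter_le_of_iteratedDeriv`** — `‖(Δ_η)^[N] φ (t)‖ ≤ η^N·B` if `‖φ^{(N)}‖ ≤ B` (`φ : ℝ → F` of class `C^N`, `η ≥ 0`);
  `fwdDiff_iter_smul_single_apply` — the continuum difference along `e_l` is the 1-D difference of the line restriction;
* §3 `framePosKernel_eq_conj` — `Ǩ_L(z) = conj(L⁻² Σ_q χ_q(z) K(p_q))` (real samples), so `TorusFourierDyadic*` applies to `‖Ǩ_L‖`;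
  `abs_fwdDiff_iter_sample_le` — the coarse axis differences of the samples at block scale `A` are `≤ (π/A)^N B_N`;
* §4 **`sum_torusSupNorm_mul_norm_framePosKernel_le_dyadic`** (general two orders `N₁, N₂`, shell form) and
  **`sum_torusSupNorm_mul_norm_framePosKernel_le`** (`N₁ = 1`, `N₂ = 3`, free crossover `t`).

Everything is proved; no definitions, no named facts.

## Sources

A. Zygmund, *Trigonometric Series* Vol. I, CUP 2002, Ch. VI §3, Thm 3.1 (Bernstein) [`Zygmund2002`]; G. Benfatto, A. Giuliani,
V. Mastropietro, Ann. Henri Poincaré 4 (2003) 137–193, §1.2 (2.10) (the counterterm and its position kernel) [`BenfattoGiulianiMastropietro2003`];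
S. Friedli, Y. Velenik, CUP 2017, §10.4 [`FriedliVelenik2017`].
-/

noncomputable section

namespace Literature.MathematicalPhysics.QuantumLattice

open Finset Literature.Probability.LatticeModels
open scoped Real ComplexConjugate

variable {L : ℕ} [NeZero L]

/-! ### §1 Samples of a periodic function: lattice differences are continuum differences -/

omit [NeZero L] in
/-- Forward differences commute with the inclusion `ℝ ↪ ℂ`. [cite: Zygmund2002, Ch. VI §3 (proof of Thm 3.1)] -/
theorem fwdDiff_iter_ofReal {M : Type*} [AddCommMonoid M] (v : M) :
    ∀ (N : ℕ) (f : M → ℝ) (q : M), ((fwdDiff v)^[N] (fun q => (f q : ℂ))) q = ((((fwdDiff v)^[N] f) q : ℝ) : ℂ)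
  | 0, f, q => rfl
  | N + 1, f, q => by
    rw [Function.iterate_succ_apply, Function.iterate_succ_apply]
    have h : fwdDiff v (fun q => (f q : ℂ)) = fun q => ((fwdDiff v f q : ℝ) : ℂ) := by
      funext q
      simp only [fwdDiff, Complex.ofReal_sub]
    rw [h]
    exact fwdDiff_iter_ofReal v N (fwdDiff v f) q

/-- **Lattice differences of samples are sampled continuum differences**: for a `(2πℤ)²`-periodic `Φ` and the axis step `m•e_l`
of the momentum torus `(ℤ/Lℤ)²`, `(Δ_{m•e_l}^N (Φ ∘ p))(q) = (Δ_{(2πm/L)e_l}^N Φ)(p_q)` (`p_q = 2πq/L`).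
[cite: BenfattoGiulianiMastropietro2003, §1.2 The model (2.10)] -/
theorem fwdDiff_iter_sample_eq {G : Type*} [AddCommGroup G] (l : Fin 2) (m : ℕ) :
    ∀ (N : ℕ) (Φ : (Fin 2 → ℝ) → G), (∀ (p : Fin 2 → ℝ) (z : Fin 2 → ℤ), Φ (fun i => p i + z i * (2 * Real.pi)) = Φ p) →
      ∀ q : TorusSite 2 L,
        ((fwdDiff (m • (Pi.single l (1 : ZMod L) : TorusSite 2 L)))^[N] (fun q => Φ (latticeMomentum L q))) q =
          ((fwdDiff ((m * (2 * Real.pi / L)) • (Pi.single l (1 : ℝ) : Fin 2 → ℝ)))^[N] Φ) (latticeMomentum L q)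
  | 0, Φ, _, q => rfl
  | N + 1, Φ, hΦ, q => by
    rw [Function.iterate_succ_apply, Function.iterate_succ_apply]
    set u : Fin 2 → ℝ := (m * (2 * Real.pi / L)) • (Pi.single l (1 : ℝ) : Fin 2 → ℝ) with hu
    -- the first difference of the samples is the sample of the first continuum difference
    have h1 : fwdDiff (m • (Pi.single l (1 : ZMod L) : TorusSite 2 L)) (fun q => Φ (latticeMomentum L q)) =
        fun q => (fwdDiff u Φ) (latticeMomentum L q) := by
      funext q
      simp only [fwdDiff]
      obtain ⟨z, hz⟩ := latticeMomentum_add_smul_single_eq q l m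
      rw [hz, ← hu, hΦ]
    rw [h1]
    -- the continuum difference is again periodic
    refine fwdDiff_iter_sample_eq l m N (fwdDiff u Φ) (fun p z => ?_) q
    simp only [fwdDiff]
    have : (fun i => p i + z i * (2 * Real.pi)) + u = fun i => (p + u) i + z i * (2 * Real.pi) := by
      funext i; simp only [Pi.add_apply]; ring
    rw [this, hΦ, hΦ]

/-! ### §2 Iterated differences along a line are bounded by the iterated derivative -/

/-- **`‖(Δ_η)^[N] φ (t)‖ ≤ η^N · B`** for `φ : ℝ → F` of class `C^N` with `‖φ^{(N)}‖ ≤ B` and `η ≥ 0` (iterated mean-value theorem: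
`(Δ_η φ)^{(N)} = Δ_η (φ^{(N)})` and `‖Δ_η ψ‖ ≤ η‖ψ′‖_∞`). [cite: Zygmund2002, Ch. VI §3 (proof of Thm 3.1)] -/
theorem norm_fwdDiff_iter_le_of_iteratedDeriv {F : Type*} [NormedAddCommGroup F] [NormedSpace ℝ F] {η : ℝ} (hη : 0 ≤ η) :
    ∀ (N : ℕ) (φ : ℝ → F) (B : ℝ), ContDiff ℝ N φ → (∀ t, ‖iteratedDeriv N φ t‖ ≤ B) →
      ∀ t, ‖((fwdDiff η)^[N] φ) t‖ ≤ η ^ N * B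
  | 0, φ, B, _, hB, t => by simpa using hB t
  | N + 1, φ, B, hφ, hB, t => by
    rw [Function.iterate_succ_apply]
    set ψ : ℝ → F := fwdDiff η φ with hψ
    have hshift : ContDiff ℝ (N + 1) (fun z => φ (z + η)) := hφ.comp (contDiff_id.add contDiff_const)
    have hψ' : ContDiff ℝ (N + 1) ψ := by
      have : ψ = (fun z => φ (z + η)) - φ := by funext z; simp [hψ, fwdDiff]
      rw [this]
      exact hshift.sub hφ
    have hψN : ContDiff ℝ N ψ := hψ'.of_le (by exact_mod_cast Nat.le_succ N)
    -- `ψ^{(N)}(s) = φ^{(N)}(s + η) - φ^{(N)}(s)`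
    have hder : ∀ s, iteratedDeriv N ψ s = iteratedDeriv N φ (s + η) - iteratedDeriv N φ s := by
      intro s
      have h1 : ψ = (fun z => φ (z + η)) - φ := by funext z; simp [hψ, fwdDiff]
      rw [h1, iteratedDeriv_sub (hshift.contDiffAt.of_le (by exact_mod_cast Nat.le_succ N))
        (hφ.contDiffAt.of_le (by exact_mod_cast Nat.le_succ N))]
      rw [iteratedDeriv_comp_add_const N φ η]
    -- mean value: `‖φ^{(N)}(s + η) - φ^{(N)}(s)‖ ≤ B·η`
    have hdiff : Differentiable ℝ (iteratedDeriv N φ) :=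
      hφ.differentiable_iteratedDeriv N (by exact_mod_cast Nat.lt_succ_self N)
    have hB' : ∀ s, ‖iteratedDeriv N ψ s‖ ≤ η * B := by
      intro s
      rw [hder]
      have hmv := Convex.norm_image_sub_le_of_norm_deriv_le (f := iteratedDeriv N φ) (s := Set.univ) (x := s) (y := s + η)
        (fun x _ => hdiff.differentiableAt) (fun x _ => by rw [← iteratedDeriv_succ]; exact hB x) convex_univ
        (Set.mem_univ _) (Set.mem_univ _)
      rw [add_sub_cancel_left, Real.norm_of_nonneg hη] at hmv
      linarith
    calc ‖((fwdDiff η)^[N] ψ) t‖ ≤ η ^ N * (η * B) := norm_fwdDiff_iter_le_of_iteratedDeriv hη N ψ (η * B) hψN hB' t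
      _ = η ^ (N + 1) * B := by ring

/-- The continuum difference along the axis `e_l` is the 1-D difference of the line restriction:
`(Δ_{η e_l}^N Φ)(p) = (Δ_η (s ↦ Φ(p + s e_l)))^[N] (0)`. [cite: Zygmund2002, Ch. VI §3 (proof of Thm 3.1)] -/
theorem fwdDiff_iter_smul_single_apply {G : Type*} [AddCommGroup G] (Φ : (Fin 2 → ℝ) → G) (l : Fin 2) (η : ℝ) (N : ℕ)
    (p : Fin 2 → ℝ) :
    ((fwdDiff (η • (Pi.single l (1 : ℝ) : Fin 2 → ℝ)))^[N] Φ) p =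
      ((fwdDiff η)^[N] (fun s : ℝ => Φ (p + s • (Pi.single l (1 : ℝ) : Fin 2 → ℝ)))) 0 := by
  rw [fwdDiff_iter_eq_sum_shift, fwdDiff_iter_eq_sum_shift]
  refine sum_congr rfl fun k _ => ?_
  simp only [zero_add, smul_assoc]

/-! ### §3 The frame's position kernel and the coarse differences of its samples -/

/-- **`Ǩ_L(z) = conj (L⁻² Σ_q χ_q(z) K(p_q))`** (the samples are real), so `‖Ǩ_L(z)‖` is the norm of a character sum in the
convention of `TorusFourierDyadicBlocks`. [cite: BenfattoGiulianiMastropietro2003, §1.2 The model (2.10)] -/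
theorem framePosKernel_eq_conj (K : TrigPolyC4v) (z : TorusSite 2 L) :
    framePosKernel L K z =
      conj (((L : ℂ) ^ 2)⁻¹ * ∑ q : TorusSite 2 L, torusChar q z * (K.eval (latticeMomentum L q) : ℂ)) := by
  rw [framePosKernel, map_mul, map_inv₀, map_pow, Complex.conj_natCast, map_sum]
  congr 1
  exact sum_congr rfl fun q _ => by rw [map_mul, Complex.conj_ofReal, mul_comm]

/-- `‖Ǩ_L(z)‖ = ‖L⁻² Σ_q χ_q(z) K(p_q)‖`. [cite: BenfattoGiulianiMastropietro2003, §1.2 The model (2.10)] -/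
theorem norm_framePosKernel_eq (K : TrigPolyC4v) (z : TorusSite 2 L) :
    ‖framePosKernel L K z‖ = ‖((L : ℂ) ^ 2)⁻¹ * ∑ q : TorusSite 2 L, torusChar q z * (K.eval (latticeMomentum L q) : ℂ)‖ := by
  rw [framePosKernel_eq_conj, Complex.norm_conj]

/-- **The coarse axis differences of the samples at block scale `A`**: if the `N`-th derivatives of the line restrictions
`s ↦ K(p + s e_l)` are bounded by `B` (all `p`, both axes), then for `0 < A`, `2A ≤ L`, every axis `l` and every `q`,
`‖(Δ_{m(A)•e_l}^N (K ∘ p))(q)‖ ≤ (π/A)^N · B`. [cite: Zygmund2002, Ch. VI §3 (proof of Thm 3.1)] -/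
theorem norm_fwdDiff_iter_sample_le (K : TrigPolyC4v) {N : ℕ} {B : ℝ}
    (hK : ∀ (l : Fin 2) (p : Fin 2 → ℝ), ContDiff ℝ N (fun s : ℝ => K.eval (p + s • (Pi.single l (1 : ℝ) : Fin 2 → ℝ))) ∧
      ∀ t, ‖iteratedDeriv N (fun s : ℝ => K.eval (p + s • (Pi.single l (1 : ℝ) : Fin 2 → ℝ))) t‖ ≤ B)
    {A : ℕ} (hA : 0 < A) (hAL : 2 * A ≤ L) (l : Fin 2) (q : TorusSite 2 L) :
    ‖((fwdDiff (blockStep L A • (Pi.single l (1 : ZMod L) : TorusSite 2 L)))^[N]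
        (fun q => (K.eval (latticeMomentum L q) : ℂ))) q‖ ≤ (π / A) ^ N * B := by
  set η : ℝ := blockStep L A * (2 * Real.pi / L) with hη
  have hη0 : 0 ≤ η := by rw [hη]; positivity
  have hηle : η ≤ π / A := by
    have := two_pi_mul_blockStep_div_le (L := L) hA hAL
    rw [hη]
    calc (blockStep L A : ℝ) * (2 * π / L) = 2 * π * (blockStep L A : ℝ) / L := by ring
      _ ≤ π / A := this
  have hB0 : 0 ≤ B := le_trans (norm_nonneg _) ((hK l 0).2 0)
  rw [fwdDiff_iter_ofReal, Complex.norm_real, Real.norm_eq_abs,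
    fwdDiff_iter_sample_eq l (blockStep L A) N K.eval (fun p z => K.eval_periodic p z) q, ← hη,
    fwdDiff_iter_smul_single_apply]
  set p := latticeMomentum L q
  have h := norm_fwdDiff_iter_le_of_iteratedDeriv hη0 N (fun s : ℝ => K.eval (p + s • (Pi.single l (1 : ℝ) : Fin 2 → ℝ))) B
    (hK l p).1 (hK l p).2 0
  rw [Real.norm_eq_abs] at h
  exact h.trans (mul_le_mul_of_nonneg_right (pow_le_pow_left₀ hη0 hηle N) hB0)

/-! ### §4 The first moment of the frame's position kernel -/

/-- **Dyadic first-moment bound, shell form**: with two directional derivative laws `‖∂^{N₁}K‖ ≤ B₁`, `‖∂^{N₂}K‖ ≤ B₂` (line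
restrictions along both axes, all base points),
`Σ_z |z̃|_∞·‖Ǩ_L(z)‖ ≤ Σ_{j ≤ log₂ L} 8√2·4^j · min((4π)^{N₁} 2^{-jN₁} B₁, (4π)^{N₂} 2^{-jN₂} B₂)` — each dyadic shell paid by the better law.
[cite: Zygmund2002, Ch. VI §3 Thm 3.1] -/
theorem sum_torusSupNorm_mul_norm_framePosKernel_le_dyadic (K : TrigPolyC4v) {N₁ N₂ : ℕ} {B₁ B₂ : ℝ}
    (hK₁ : ∀ (l : Fin 2) (p : Fin 2 → ℝ), ContDiff ℝ N₁ (fun s : ℝ => K.eval (p + s • (Pi.single l (1 : ℝ) : Fin 2 → ℝ))) ∧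
      ∀ t, ‖iteratedDeriv N₁ (fun s : ℝ => K.eval (p + s • (Pi.single l (1 : ℝ) : Fin 2 → ℝ))) t‖ ≤ B₁)
    (hK₂ : ∀ (l : Fin 2) (p : Fin 2 → ℝ), ContDiff ℝ N₂ (fun s : ℝ => K.eval (p + s • (Pi.single l (1 : ℝ) : Fin 2 → ℝ))) ∧
      ∀ t, ‖iteratedDeriv N₂ (fun s : ℝ => K.eval (p + s • (Pi.single l (1 : ℝ) : Fin 2 → ℝ))) t‖ ≤ B₂) :
    ∑ z : TorusSite 2 L, (torusSupNorm z : ℝ) * ‖framePosKernel L K z‖ ≤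
      ∑ j ∈ range (Nat.log 2 L + 1), 8 * Real.sqrt 2 * (4 : ℝ) ^ j *
        min ((4 * π) ^ N₁ * ((2 : ℝ) ^ j)⁻¹ ^ N₁ * B₁) ((4 * π) ^ N₂ * ((2 : ℝ) ^ j)⁻¹ ^ N₂ * B₂) := by
  have hB₁0 : 0 ≤ B₁ := le_trans (norm_nonneg _) ((hK₁ 0 0).2 0)
  have hB₂0 : 0 ≤ B₂ := le_trans (norm_nonneg _) ((hK₂ 0 0).2 0)
  set h : TorusSite 2 L → ℂ := fun q => (K.eval (latticeMomentum L q) : ℂ) with hh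
  have hmain := sum_weight_mul_norm_kernel_le_dyadic (d := 2) (L := L) h (fun z => (torusSupNorm z : ℝ))
    (fun z => Nat.cast_nonneg _) N₁ N₂ (fun j => 2 * (2 : ℝ) ^ j) (fun j => (π / (2 : ℝ) ^ j) ^ N₁ * B₁)
    (fun j => (π / (2 : ℝ) ^ j) ^ N₂ * B₂) (fun j => by positivity) (fun j => by positivity) (fun j => by positivity)
    (fun j z hz => ?_) (fun j hjL i k => ?_) (fun j hjL i k => ?_)
  rotate_left
  · -- weight ≤ 2·2^j on the shell
    have := (mem_cubeShell.1 hz).2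
    have h2 : ((torusSupNorm z : ℕ) : ℝ) < ((2 * 2 ^ j : ℕ) : ℝ) := by exact_mod_cast this
    push_cast at h2
    exact h2.le
  · have := norm_fwdDiff_iter_sample_le K hK₁ (Nat.two_pow_pos j) hjL i k
    push_cast at this ⊢
    exact this
  · have := norm_fwdDiff_iter_sample_le K hK₂ (Nat.two_pow_pos j) hjL i k
    push_cast at this ⊢
    exact this
  simp_rw [norm_framePosKernel_eq]
  have h0 : ((torusSupNorm (0 : TorusSite 2 L) : ℕ) : ℝ) = 0 := by
    rw [(torusSupNorm_eq_zero_iff (0 : TorusSite 2 L)).2 rfl, Nat.cast_zero]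
  rw [h0, zero_mul, zero_add] at hmain
  push_cast at hmain
  refine hmain.trans (sum_le_sum fun j _ => le_of_eq ?_)
  have hs4 : Real.sqrt ((4 * (2 : ℝ) ^ j) ^ 2) = 4 * 2 ^ j := Real.sqrt_sq (by positivity)
  have e₁ : (4 : ℝ) ^ N₁ * ((π / (2 : ℝ) ^ j) ^ N₁ * B₁) = (4 * π) ^ N₁ * ((2 : ℝ) ^ j)⁻¹ ^ N₁ * B₁ := by
    rw [div_eq_mul_inv, mul_pow, mul_pow]; ring
  have e₂ : (4 : ℝ) ^ N₂ * ((π / (2 : ℝ) ^ j) ^ N₂ * B₂) = (4 * π) ^ N₂ * ((2 : ℝ) ^ j)⁻¹ ^ N₂ * B₂ := by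
    rw [div_eq_mul_inv, mul_pow, mul_pow]; ring
  have h4j : (4 : ℝ) ^ j = 2 ^ j * 2 ^ j := by rw [← mul_pow]; norm_num
  rw [hs4, e₁, e₂, h4j]
  ring

/-- **The first moment of the frame's lattice position kernel from the FIRST and THIRD directional derivative laws**: if
`|∂_s K(p + s e_l)| ≤ B₁` and `|∂_s³ K(p + s e_l)| ≤ B₃` for all base points and both axes, then for every integer crossover `t`,
`Σ_z |z̃|_∞·‖Ǩ_L(z)‖ ≤ 32√2·π·B₁·2^t + 1024√2·π³·B₃/2^t`, uniformly in `L` (so `≲ √(B₁B₃)` at `2^t ≍ √(B₃/B₁)`; for a frame piece with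
`B₁ ≍ Gfr₁U²4^{-n}`, `B₃ ≍ Gfr₃U²4^{n}` take `2^t = 4^n`: `≲ √(Gfr₁Gfr₃)·U²` uniformly in `n`). [cite: Zygmund2002, Ch. VI §3 Thm 3.1] -/
theorem sum_torusSupNorm_mul_norm_framePosKernel_le (K : TrigPolyC4v) {B₁ B₃ : ℝ}
    (hK₁ : ∀ (l : Fin 2) (p : Fin 2 → ℝ), ContDiff ℝ 1 (fun s : ℝ => K.eval (p + s • (Pi.single l (1 : ℝ) : Fin 2 → ℝ))) ∧
      ∀ t, ‖iteratedDeriv 1 (fun s : ℝ => K.eval (p + s • (Pi.single l (1 : ℝ) : Fin 2 → ℝ))) t‖ ≤ B₁)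
    (hK₃ : ∀ (l : Fin 2) (p : Fin 2 → ℝ), ContDiff ℝ 3 (fun s : ℝ => K.eval (p + s • (Pi.single l (1 : ℝ) : Fin 2 → ℝ))) ∧
      ∀ t, ‖iteratedDeriv 3 (fun s : ℝ => K.eval (p + s • (Pi.single l (1 : ℝ) : Fin 2 → ℝ))) t‖ ≤ B₃)
    (t : ℕ) :
    ∑ z : TorusSite 2 L, (torusSupNorm z : ℝ) * ‖framePosKernel L K z‖ ≤
      32 * Real.sqrt 2 * π * B₁ * 2 ^ t + 1024 * Real.sqrt 2 * π ^ 3 * B₃ / 2 ^ t := by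
  have hB₁0 : 0 ≤ B₁ := le_trans (norm_nonneg _) ((hK₁ 0 0).2 0)
  have hB₃0 : 0 ≤ B₃ := le_trans (norm_nonneg _) ((hK₃ 0 0).2 0)
  have hdy := sum_torusSupNorm_mul_norm_framePosKernel_le_dyadic (L := L) K hK₁ hK₃
  set a : ℝ := 32 * Real.sqrt 2 * π * B₁ with ha
  set b : ℝ := 512 * Real.sqrt 2 * π ^ 3 * B₃ with hb
  have ha0 : 0 ≤ a := by rw [ha]; positivity
  have hb0 : 0 ≤ b := by rw [hb]; positivity
  -- each shell term is `≤ min (a·2^j) (b/2^j)`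
  have hterm : ∀ j : ℕ, 8 * Real.sqrt 2 * (4 : ℝ) ^ j *
      min ((4 * π) ^ 1 * ((2 : ℝ) ^ j)⁻¹ ^ 1 * B₁) ((4 * π) ^ 3 * ((2 : ℝ) ^ j)⁻¹ ^ 3 * B₃) ≤ min (a * 2 ^ j) (b / 2 ^ j) := by
    intro j
    have hc : 0 ≤ 8 * Real.sqrt 2 * (4 : ℝ) ^ j := by positivity
    have h2j : (0 : ℝ) < 2 ^ j := by positivity
    have h4j : (4 : ℝ) ^ j = 2 ^ j * 2 ^ j := by rw [← mul_pow]; norm_num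
    refine le_min ?_ ?_
    · calc 8 * Real.sqrt 2 * (4 : ℝ) ^ j * min ((4 * π) ^ 1 * ((2 : ℝ) ^ j)⁻¹ ^ 1 * B₁) ((4 * π) ^ 3 * ((2 : ℝ) ^ j)⁻¹ ^ 3 * B₃)
          ≤ 8 * Real.sqrt 2 * (4 : ℝ) ^ j * ((4 * π) ^ 1 * ((2 : ℝ) ^ j)⁻¹ ^ 1 * B₁) :=
            mul_le_mul_of_nonneg_left (min_le_left _ _) hc
        _ = a * 2 ^ j := by rw [ha, h4j]; field_simp; ring
    · calc 8 * Real.sqrt 2 * (4 : ℝ) ^ j * min ((4 * π) ^ 1 * ((2 : ℝ) ^ j)⁻¹ ^ 1 * B₁) ((4 * π) ^ 3 * ((2 : ℝ) ^ j)⁻¹ ^ 3 * B₃)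
          ≤ 8 * Real.sqrt 2 * (4 : ℝ) ^ j * ((4 * π) ^ 3 * ((2 : ℝ) ^ j)⁻¹ ^ 3 * B₃) :=
            mul_le_mul_of_nonneg_left (min_le_right _ _) hc
        _ = b / 2 ^ j := by rw [hb, h4j]; field_simp; ring
  calc ∑ z : TorusSite 2 L, (torusSupNorm z : ℝ) * ‖framePosKernel L K z‖
      ≤ ∑ j ∈ range (Nat.log 2 L + 1), min (a * 2 ^ j) (b / 2 ^ j) := hdy.trans (sum_le_sum fun j _ => hterm j)
    _ ≤ a * 2 ^ t + 2 * b / 2 ^ t := sum_min_geom_le ha0 hb0 _ t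
    _ = 32 * Real.sqrt 2 * π * B₁ * 2 ^ t + 1024 * Real.sqrt 2 * π ^ 3 * B₃ / 2 ^ t := by rw [ha, hb]; ring

end Literature.MathematicalPhysics.QuantumLattice

end
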